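import Literature.MathematicalPhysics.QuantumFieldTheory.Balaban1983to89.T4IndicatorShell

/-!
# `Balaban1983to89.T4AdditiveClass` — node U5 / spine estimate NE7 of the uniqueness spine: the ADDITIVELY MATCHED
CLASS of the hybrid lemma "MATCHING MOD CONSTANTS, hybrid (term-wise + weight), Σδ_K < ∞" (cell `pub-balaban`, T⁴
fan-out row T4-U5.E-NE7-PROVE-P2* / self-proposed row T4-U5.E-NE7-ADDCLASS* of `CLAIMS.log`; node U5 of `t4/T4-DAG.md`
v20 §6 (NE7 = NE7b + NE7c); kernel siblings `T4HybridMatching` (the two-class lemma `HybridSandwich`,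
`cauchy_of_hybrid`, `hybridSandwich_sharp`), `T4WeightBudget` (`RelWeightBound`, `cauchy_of_relWeightBound`),
`T4IndicatorShell` (`ShellWeightBound`, `cauchy_of_relWeightBound_shell`), `T4BadClassBooking` (the saturation wall
`not_relWeightBound_of_saturated`, cited BY NAME, not imported), `T4SiblingInsertion` v1.2 §6 (exit (B′) + the floor
(Y) `UniformSmallFieldFloor`, cited BY NAME); this lineage's record `t4/T4-EST-NE7-P2.md`; Mathlib + `T4IndicatorShell`
only) — VERSION v1.1 (2026-08-19, gen 6, same seat): v1 = p187548 (commit 2a1472b918ba; §1–§4, byte-identical below) +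
APPEND-ONLY §5 (comparison with the two two-class bookings: `add_match_of_sandwich`; the FLOOR-FREE separation toy
`SanityFloorFree`) + a PRECISION of the paragraph THE RESIDUAL (ceiling vs floor; answers the U5 referee's
`t4/T4-REF-U5.md` v1.4 → v1.4.1, journal l.51882, and item (f) of the XREAD-CLAIM l.51908)

HONEST FRAMING (cell `pub-balaban`, T4-DAG PAGE 1).  The cell's T4 target is the existence AND uniqueness of the
continuum limit of Bałaban's unit-scale averaged loop expectations on a FINITE torus (rung (B)+1) — strictly beyond
ultraviolet stability ([Balaban1989LargeFieldII] Thm 1 p. 355); it is NOT infinite volume, NOT the Yang–Mills mass gap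
and NOT the Clay problem.  NOTHING of the run-A/run-B comparison is printed: the manuscripts construct ONE run.  This
module is bookkeeping arithmetic about the cell's own matching shapes (finite sums, `Real.log`, `Summable`); NOTHING of
Bałaban's estimates is proved or assumed, every analytic input is an explicit hypothesis (no `BetaPertH`, (B) or (B^μ)
is hidden in a definition — none occurs), and the module does not decide NE7. [folklore arithmetic]

THE QUESTION (node U5's BOOKING RULE, third class).  Node U5 compares the dressed unit-scale partition functions of two
runs (cutoffs `K`, `K+1`) written after node U5d's partial summation as finite sums `Σ_{τ∈T_K} A_K(t,τ)`,
`Σ_{τ∈T_K} B_K(t,τ)` of nonnegative term weights.  The kernel hybrid lemma `T4HybridMatching.HybridSandwich.abs_log_sum_sub_le`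
knows TWO classes: GOOD terms, sandwiched term-wise modulo a `t`-independent constant `c_K`
(`e^{c−r} a_τ ≤ b_τ ≤ e^{c+r} a_τ`, remainder `r = vol·δ_K`), and BAD terms, of relative weight `≤ W_K` in each run
separately — and the weight slot books ONLY summably-vanishing classes: a class keeping a relative fraction `≥ c > 0` at
infinitely many `K` admits no `RelWeightBound` for any `W` (`T4BadClassBooking.not_relWeightBound_of_saturated`,
`T4ShellCount` §2, `T4BookingNecessity`; the U5 referee's record `t4/T4-REF-U5.md` v1.4 §9.2: "every K-uniform class is
MATCHED, never WEIGHED").  The cell's exit census for the young ℝ-reshaped events of design (η) (GAPS G-ne7bp1g5-1 (iii),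
conceded C-ne7cp2-8: "(B2) … or a two-run MATCHING of the ℝ-quotients (term-wise or aggregated per slot)") names a
THIRD way of booking a K-uniform class that the two-class lemma cannot express: a class `Y` whose terms are NOT
sandwiched term-wise (no pairing term by term is claimed) and NOT small, but whose two class sums are matched IN
AGGREGATE and ADDITIVELY modulo the SAME constant, `|Σ_Y b − e^{c} Σ_Y a| ≤ m_K·e^{c}·Σ_T a`, with a summable MISMATCH
`Σ_K m_K < ∞`.  The printed anchor of the aggregate notion is the normalization property of the ℝ-operation and the
"equivalence" of densities — [Balaban1989LargeFieldI] p. 176 (0.4) and p. 193, quoted below: print's operations preserve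
INTEGRALS of densities, not individual terms — and the printed MODEL of additive bookkeeping is King's (3.10)–(3.13)
[King1986] (as in `T4WeightBudget`).  This module types that third class and proves its booking rule; it decides nothing
between the cell's exits ((B′)+(Y) of `T4SiblingInsertion` v1.2 §6 vs an additively matched class) and asserts no
matching of anything of Bałaban's.

CITATION HEADER (lean-in-tree rule 2026-08-18).  This seat (`b2b-balaban-t4-ne7-p2` gen 6) read the RENDERS
`b2b-balaban-ref1/pages/1989-cmp122-large-field-I/1989-cmp122-large-field-I-p002-x2.png` and `-p019-x2.png` (journal
pp. 176, 193 of T. Bałaban, *Large field renormalization. I. The basic step of the ℝ operation*, Commun. Math. Phys.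
**122** (1989) 175–202 [Balaban1989LargeFieldI], cell paper B15; PDF page = journal page − 174) and
`…/1989-cmp122-large-field-II/1989-cmp122-large-field-II-p029-x2.png` (journal p. 383 of T. Bałaban, *Large field
renormalization. II. Localization, exponentiation, and bounds for the ℝ operation*, Commun. Math. Phys. **122** (1989)
355–392 [Balaban1989LargeFieldII], cell paper B16; PDF page = journal page − 354) as images this generation, and quotes
VERBATIM:
* B15 p. 176: *"a large field expression is replaced by the corresponding small field expression in such a way, that
  integrals of the densities are unchanged."*; *"It satisfies the basic normalization property ∫dV(ℝρ)(V) = ∫dVρ(V).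
  (0.4)"*; *"The quotients are still small, because some small factors in the regions Z′ are left for the densities in
  the numerator."* (the ℝ-operation is INTEGRAL-preserving and its quotients carry small factors — the shape "aggregate
  identity + small aggregate defect", never a term-wise identity).
* B15 p. 193: *"All the above transformations preserve the k^{th} density ρ_k, they change only the representation of
  this density."*; *"The equality sign is replaced by the equivalence sign, the equivalence means that both sides have
  equal integrals over the space of fields V_k."* (print's own notion of sameness between two representations is
  equality of INTEGRALS — the aggregate).
* B16 p. 383: *"This is the largest factor among all the small factors we have obtained from the large field
  characteristic functions in the preparatory steps. We assume that 2p₁ − (d + 5)r₀ > p₀, and we estimate the factors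
  by exp(−p₀(g_j))."* followed by the bound (1.79) `T′_k(X)1 ≤ sup exp{Σ_{j=1}^{k} O(1)M^dR_j^{d+1}d′_j(Z_j)}·∏_j∏_i
  exp(−½γ₀A₁²p₀²(g_j)(d′_j(Z_j^{(i)}) + 1) − 2p₀(g_j))∏′exp(−p₀(g_j))` (the printed large-field SUPPRESSION per
  creation step = per AGE of a component: a ONE-RUN size, K-uniform on a K-independent young band — the reason the
  young class is not weighable, `T4ShellSuppressionRoute` §2, and the currency in which a class CONSTANT, not a rate, is
  available).
The manuscripts are quoted for CONTEXT and SHAPE only; no disputed estimate of theirs is used anywhere below, and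
nothing printed is asserted.

WHAT IS KERNEL-CHECKED.
* §1 THE THREE-CLASS SANDWICH AND ITS BOOKING RULE.  `AddHybridSandwich T G Y a b c r W m` (hypothesis SHAPE: good
  class `G`, additively matched class `Y` disjoint from `G`, bad rest `T ∖ (G ∪ Y)` of relative weight `≤ W` in each
  run, aggregate matching of `Y` with mismatch `m` relative to run A's total); the two-sided bounds `lower_bound`
  (`e^{c−r}(1 − (W + m·e^{r}))Σ_T a ≤ Σ_T b`, for `r ≥ 0`), `upper_bound'` (`(1 − W)Σ_T b ≤ e^{c+r}(1 + m)Σ_T a`),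
  `upper_bound` (`(1 − (W + m·e^{r}))Σ_T b ≤ e^{c+r}Σ_T a`, via `one_sub_effWeight_mul_le`); THE RULE
  `abs_log_sum_sub_le`: `|log Σ_T b − log Σ_T a − c| ≤ r − log(1 − (W + m·e^{r}))` for `r, W ≥ 0`, `W + m·e^{r} < 1`,
  `Σ_T a > 0` — the class enters the WEIGHT SLOT of `T4HybridMatching.hybridDelta` THROUGH ITS MISMATCH `m·e^{r}`, NOT
  through its weight (nothing is assumed about `Σ_Y a / Σ_T a`); SHARP at `r = 0` for all `W, m ≥ 0`, `W + m < 1`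
  (`addHybridSandwich_sharp`: two terms, equality); `mono`; the degenerate instances `of_hybridSandwich` (`Y = ∅`,
  `m = 0`: the two-class lemma verbatim), `of_aggregate` / `abs_log_sub_le_of_aggregate` (`G = ∅`, `Y = T`, `W = 0`:
  pure aggregate matching books with `−log(1 − m)`); the constructor from a given bad class `of_bad` (good class
  `T ∖ (Bad ∪ Y)`).
* §2 PRODUCERS OF THE MISMATCH.  `add_match_of_termwise` (term-wise ADDITIVE defects `|b_τ − e^{c}a_τ| ≤ e^{c}d_τ` with
  `Σ_Y d ≤ m·Σ_T a` ⇒ aggregate matching; the aggregate hypothesis is the WEAKER one — it also admits cancellations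
  inside the class); `sum_defect_le_of_rate`, `add_match_of_rate` (defects = RATE × SIZE, `d_τ ≤ ε·s_τ`, and a CLASS
  CONSTANT `Σ_Y s ≤ C·Σ_T a` ⇒ `m = ε·C`).  THE TWO CURRENCIES, typed: `ε = ε_K` is a TWO-RUN rate (UV-anchored,
  summable in `K` — node U1b's (F∞) width / U4′'s running-coupling discrepancy), `C` is a ONE-RUN class constant
  (IR-anchored, merely FINITE uniformly in `K`; no smallness, not even `C < 1`).  A defect relative to the term's OWN
  weight (`s_τ = a_τ`, `C ≤ 1`) is a term-wise sandwich in disguise (then `τ` is a good term with `r ≈ ε`); the class is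
  genuinely new exactly when the natural reference size `s_τ` exceeds `a_τ` (e.g. an unrestricted fibre integral of which
  `a_τ` is a restricted part, or the sum of the branches of one decomposition of unity of which `τ` is one branch).
* §3 THE PLUGS INTO NODE U6.  `addWeight vol δ W m K = W K + m K·exp(vol·δ K)` (the effective weight sequence),
  `summable_addWeight` (`Σ W, Σ m, Σ δ < ∞` ⇒ summable: the class is summable in `K` iff its MISMATCHES are);
  `matchingModConstants_of_addHybrid` / `cauchy_of_addHybrid` (mirror of `T4HybridMatching.matchingModConstants_of_hybrid`
  / `cauchy_of_hybrid`: `MatchingModConstants vol l₀ (hybridDelta vol δ (addWeight vol δ W m)) Z`, its summability, the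
  Cauchy property of every `K ↦ genFun Z K t`, `|t| ≤ l₀`, uniform convergence to `genFunLim Z` — through
  `T4CauchySum.cauchySeq_genFun` / `tendstoUniformlyOn_genFun` verbatim); `cauchy_of_relWeightBound_add` (NE7b-output
  `RelWeightBound … Bad W` + term-wise sandwich OFF `Bad ∪ Y` + aggregate matching of `Y` with the same constants — the
  three-class twin of `T4WeightBudget.cauchy_of_relWeightBound`); `refY`, `sum_refY_refVal`,
  `mem_refT_sdiff_refBad_union_refY`, `cauchy_of_relWeightBound_shell_add` (design (i)/(η): + NE7c-output
  `ShellWeightBound … Wsh`, core sandwich OFF `Bad ∪ Y`, the class refined into both of its pieces — the three-class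
  twin of `T4IndicatorShell.cauchy_of_relWeightBound_shell`, weight slot `W + Wsh + m·exp(vol·δ)`).
* §4 SEPARATION FROM THE SATURATION WALL (non-vacuity with a NON-SMALL class).  A two-term toy (`Sanity`): the class
  `{true}` keeps the CONSTANT fraction `q₀` of run A's total at every `K` (`class_weight` — the `Saturated` shape of
  `T4BadClassBooking`, hence NO weight booking for any `W` by `not_relWeightBound_of_saturated`, cited by name), the good
  term is matched exactly modulo `c_K = −log(1 + η_K)` and the class additively modulo the same `c_K` with mismatch `η_K`
  (`addHybridSandwich`); `books`: for `Σ η < ∞` all conclusions of `cauchy_of_addHybrid` hold (trivially so for the sums,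
  `Z ≡ 1` — the content is the INHABITANT of the binders with `W ≡ 0`, `δ ≡ 0`, `m = η`, class fraction `q₀ ∈ [0,1]`
  arbitrary); a closed instance `q₀ = 1/2`, `η_K = 2^{−(K+1)}`.
* §5 (v1.1) COMPARISON WITH THE TWO TWO-CLASS BOOKINGS.  `add_match_of_sandwich`: a sub-family `Y ⊆ T` that IS
  sandwiched term-wise (`e^{c−r}a_τ ≤ b_τ ≤ e^{c+r}a_τ`, `r ≥ 0`) is additively matched modulo the same `c` with mismatch
  `e^{r} − 1 ≈ r` — the additive class CONTAINS the good-class bookkeeping to first order.  `SanityFloorFree`: a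
  two-term toy whose class term has FLOOR RATIO `q K = a/s = 1/(K+3) → 0` (`tendsto_q`: no uniform floor) with
  `Σ q = ∞` (`not_summable_q`: no weight booking) and additive rate `ε = q²` against the reference size `s = 1`
  (summable, but `ε/q = q` is not): `no_twoClass_booking` — there are NO sequences `G, c, r, W` with
  `T4HybridMatching.HybridSandwich univ (G K) (A K) (B K) (c K) (r K) (W K)` for all `K` and BOTH `Σ r < ∞`, `Σ W < ∞`
  (class good ⇒ the bulk pins `c ≤ r` and the class forces `2r ≥ log(1 + q) ≥ q/2`; a term bad ⇒ `W ≥ q`); yet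
  `addHybridSandwich` / `books`: the three-class data with `r = W = 0`, `m K = q²/(1 − q − q²)` (`summable_m`,
  `m_lt_one`) book through `cauchy_of_addHybrid`.  The weight half of the obstruction is the divergence wall of
  `T4BadClassBooking` (`Σ = ∞` form); the sandwich half is the FLOOR: term-wise, the two-run defect is measured against
  `a_τ`, so `r ≳ ε/q` = rate over floor ratio (cf. `T4SiblingInsertion` v1.2 §6, `r̄ = 1/c`); the additive class
  measures it against `s_τ` and needs NO floor.

THE RESIDUAL, HONESTLY (what the additive class does NOT remove; records `t4/T4-EST-NE7-P2.md` v1.5 §10, GAPS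
G-ne7p2-5).  The class constant `C` of §2 (`Σ_{τ∈Y} s_τ ≤ C·Σ_{τ∈T} a_τ`, ONE `C < ∞` for all `K` and `|t| ≤ l₀`) is an
ESTIMATE about ONE run — an x-AVERAGED (summed over the class) comparison of the class's reference sizes with the
whole partition function — a CEILING (an UPPER bound of the class's reference sizes by the run's total).  For the
young ℝ-events of design (η) it stands where the term-wise path (B′) of `T4SiblingInsertion` v1.2 §6 needs the one-cube
FLOOR (Y) `UniformSmallFieldFloor` (a LOWER bound `a_τ ≥ c·s_τ`, uniform in the fibre / exterior, `r̄ = 1/c`).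
v1.1 PRECISION (answers the U5 referee, `t4/T4-REF-U5.md` v1.4 → v1.4.1, journal l.51882, and item (f) of the XREAD
l.51908).  v1's sentence «any K-uniform `C` extracted from print is of size `exp{O(1)M^dR^{d+1}·O(R^d)}` per young age»
imported the d′-relative LOSS that afflicts the FLOOR — (1.79)'s first factor `sup exp{Σ_j O(1)M^dR_j^{d+1}d′_j(Z_j)}`
cannot be offset inside a LOWER bound (REF-U5 v1.4.1 makes even that conditional on whole-component pricing) — and is
WITHDRAWN as mis-directed for a ceiling: print's large-field currency consists of UPPER bounds ((1.79)/(1.80); p. 383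
«we estimate the factors by exp(−p₀(g_j))», the d′-relative factor being absorbed by the `p₀` small factor exactly
there), so under the one-run identification READING (two-run reference sizes ↔ one run's restricted densities; the
species of GAPS G-ne7p2-4, NOT PRINTED for two runs) the expected size of the class constant is the young-age SIZE
budget `C = O(Σ_{a≤N} n_a·L_a·e^{−p_θ(a)}) = O(1)`, K-uniform (the `T4ShellCount.ageWeight` /
`T4BadClassBooking.AgeCover.bad_le_uniform` budget read in size currency) — finite, not summable, not necessarily
`< 1`; it enters `hlt` (`addWeight … K < 1`) against the summable rate `ε_K`, i.e. CONSTANTS and an effective `K₀`,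
never existence.  THE TRADE, exactly (kernel §5): the additive class replaces the unprinted FLOOR (Y) by the CEILING
(R-add-1) plus the additive two-run rate (R-add-2) `|b_τ − e^{c_K}a_τ| ≤ e^{c_K}ε_K·s_τ` measured against `s_τ ≥ a_τ`
— WEAKER than the relative sandwich, which measures against `a_τ` and therefore needs the floor; `a_τ/s_τ → 0` is
allowed (`SanityFloorFree.no_twoClass_booking` / `.books`).  Both (R-add-1) and (R-add-2) remain NOT PRINTED and are
NOT discharged here (GAPS G-ne7p2-5).  Species:
E2REL-b / NE7b-at-lowered-threshold in aggregate form; owner: the seat instantiating `TermRepr` / the ℝ-quotients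
(U5b), not this module.  And the two-run rate `ε_K` for the ℝ-quotients is the U5b/NE3–NE5-species closeness of the
substituted small-field expressions of the two runs on `Z′` — the same input the good terms' `hsw` needs (C-ne7cp2-8:
"the SAME floor (Y) is what `hsw` needs for the two-run comparability of ℝ's DENOMINATORS"); in the additive class the
denominators are NOT divided out term by term (no ratio `1/D_A − 1/D_B` is formed), which is the class's one structural
advantage, paid for by measuring the defect against the reference size `s_τ ≥ a_τ`.

Deliberately NOT here: which terms of a (2.18)/(1.104)-expansion form the class `Y` (the census of the young ℝ-events
is `T4SiblingInsertion` v1.2 §0/§6 and `t4/T4-EST-NE7c-P2.md` v1.5); the rate `ε_K` (nodes U1b/U4′, `T4SupCloseLiaison`,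
`T4OutputRate`); the class constant `C` (the residual above); the realized-ledger twin of `T4LipschitzLedger.cauchy_of_repr`
with an additive class (its `core_sandwich` hides the constants behind `∃ c'`; a twin with explicit `c K` is a
corollary of `cauchy_of_relWeightBound_shell_add` + `shellWeightBound_of_repr`, left to the consuming seat — one-writer
rule on `T4LipschitzLedger`); anything about NE7b proper or node U2.

All statements are `[folklore]` finite-sum / logarithm arithmetic; `0 sorry`.
-/

open Finset _root_.Filter _root_.Topology

namespace Literature.MathematicalPhysics.QuantumFieldTheory.Balaban1983to89.T4AdditiveClass

open T4HybridMatching T4CauchySum T4WeightBudget T4IndicatorShell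

/-! ## §1 The three-class hybrid sandwich and its booking rule -/

/-- HYPOTHESIS SHAPE (node U5, cell NE7 in a THREE-CLASS hybrid form — NOT in print; cell bookkeeping).  Two finite
families `a, b ≥ 0` of term weights on the index set `T` (run A / run B after node U5d's partial summation), a common
constant `c`, and three classes: GOOD terms `G ⊆ T`, sandwiched term-wise `e^{c−r} a_τ ≤ b_τ ≤ e^{c+r} a_τ`; an
ADDITIVELY MATCHED class `Y ⊆ T`, disjoint from `G`, whose two runs are matched IN AGGREGATE modulo the SAME constant,
`|Σ_Y b − e^c Σ_Y a| ≤ m · e^c · Σ_T a` (mismatch `m` relative to run A's total); and the BAD rest `T ∖ (G ∪ Y)` of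
relative weight `≤ W` in each run separately (NE7b's binder, unchanged).  With `Y = ∅`, `m = 0` this is
`T4HybridMatching.HybridSandwich` (`of_hybridSandwich`). [folklore] -/
structure AddHybridSandwich {ι : Type*} [DecidableEq ι] (T G Y : Finset ι) (a b : ι → ℝ) (c r W m : ℝ) : Prop where
  /-- the good terms are terms -/
  good_subset : G ⊆ T
  /-- the additively matched terms are terms -/
  add_subset : Y ⊆ T
  /-- no term is both good and additively matched -/
  disjoint : Disjoint G Y
  /-- run A's term weights are nonnegative -/
  nonneg_left : ∀ τ ∈ T, 0 ≤ a τ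
  /-- run B's term weights are nonnegative -/
  nonneg_right : ∀ τ ∈ T, 0 ≤ b τ
  /-- good terms, lower half of the term-wise sandwich -/
  lower : ∀ τ ∈ G, Real.exp (c - r) * a τ ≤ b τ
  /-- good terms, upper half of the term-wise sandwich -/
  upper : ∀ τ ∈ G, b τ ≤ Real.exp (c + r) * a τ
  /-- bad terms of run A have relative weight ≤ W -/
  bad_left : ∑ τ ∈ T \ (G ∪ Y), a τ ≤ W * ∑ τ ∈ T, a τ
  /-- bad terms of run B have relative weight ≤ W -/
  bad_right : ∑ τ ∈ T \ (G ∪ Y), b τ ≤ W * ∑ τ ∈ T, b τ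
  /-- the additively matched class: aggregate matching modulo the same constant `c`, mismatch `m` relative to run A's
  total -/
  add_match : |∑ τ ∈ Y, b τ - Real.exp c * ∑ τ ∈ Y, a τ| ≤ m * Real.exp c * ∑ τ ∈ T, a τ

namespace AddHybridSandwich

variable {ι : Type*} [DecidableEq ι] {T G Y : Finset ι} {a b : ι → ℝ} {c r W m : ℝ}

/-- The three-class split of any sum over `T`. [folklore] -/
theorem sum_eq (h : AddHybridSandwich T G Y a b c r W m) (f : ι → ℝ) :
    ∑ τ ∈ T, f τ = ∑ τ ∈ G, f τ + ∑ τ ∈ Y, f τ + ∑ τ ∈ T \ (G ∪ Y), f τ := by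
  have hU : G ∪ Y ⊆ T := Finset.union_subset h.good_subset h.add_subset
  rw [← Finset.sum_sdiff hU, Finset.sum_union h.disjoint]
  ring

/-- The good part of run B dominates `e^{c−r}` times the good part of run A. [folklore] -/
theorem sum_good_lower (h : AddHybridSandwich T G Y a b c r W m) :
    Real.exp (c - r) * ∑ τ ∈ G, a τ ≤ ∑ τ ∈ G, b τ := by
  rw [Finset.mul_sum]
  exact Finset.sum_le_sum h.lower

/-- The good part of run B is at most `e^{c+r}` times the good part of run A. [folklore] -/
theorem sum_good_upper (h : AddHybridSandwich T G Y a b c r W m) :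
    ∑ τ ∈ G, b τ ≤ Real.exp (c + r) * ∑ τ ∈ G, a τ := by
  rw [Finset.mul_sum]
  exact Finset.sum_le_sum h.upper

/-- The additively matched part of run B, from below. [folklore] -/
theorem sum_add_lower (h : AddHybridSandwich T G Y a b c r W m) :
    Real.exp c * ∑ τ ∈ Y, a τ - m * Real.exp c * ∑ τ ∈ T, a τ ≤ ∑ τ ∈ Y, b τ := by
  have := (abs_le.1 h.add_match).1
  linarith

/-- The additively matched part of run B, from above. [folklore] -/
theorem sum_add_upper (h : AddHybridSandwich T G Y a b c r W m) :
    ∑ τ ∈ Y, b τ ≤ Real.exp c * ∑ τ ∈ Y, a τ + m * Real.exp c * ∑ τ ∈ T, a τ := by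
  have := (abs_le.1 h.add_match).2
  linarith

/-- The mismatch is nonnegative as soon as run A's total is positive. [folklore] -/
theorem m_nonneg (h : AddHybridSandwich T G Y a b c r W m) (hpos : 0 < ∑ τ ∈ T, a τ) : 0 ≤ m := by
  by_contra hm
  have hm' : m < 0 := lt_of_not_ge hm
  have h1 : m * Real.exp c * ∑ τ ∈ T, a τ < 0 :=
    mul_neg_of_neg_of_pos (mul_neg_of_neg_of_pos hm' (Real.exp_pos c)) hpos
  linarith [(abs_nonneg _).trans h.add_match]

/-- **Lower bound**: `e^{c−r} (1 − (W + m e^r)) Σ_T a ≤ Σ_T b` (for `r ≥ 0`). [folklore] -/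
theorem lower_bound (h : AddHybridSandwich T G Y a b c r W m) (hr : 0 ≤ r) :
    Real.exp (c - r) * (1 - (W + m * Real.exp r)) * ∑ τ ∈ T, a τ ≤ ∑ τ ∈ T, b τ := by
  have eS := h.sum_eq a
  have eSB := h.sum_eq b
  have hGB := h.sum_good_lower
  have hYB := h.sum_add_lower
  have hBB : 0 ≤ ∑ τ ∈ T \ (G ∪ Y), b τ :=
    Finset.sum_nonneg fun τ hτ => h.nonneg_right τ (Finset.mem_sdiff.1 hτ).1
  have hYA : 0 ≤ ∑ τ ∈ Y, a τ := Finset.sum_nonneg fun τ hτ => h.nonneg_left τ (h.add_subset hτ)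
  have hBA := h.bad_left
  have hexp : Real.exp (c - r) * Real.exp r = Real.exp c := by
    rw [← Real.exp_add, sub_add_cancel]
  have e1 : Real.exp (c - r) ≤ Real.exp c := Real.exp_le_exp.2 (by linarith)
  have h1 : Real.exp (c - r) * ∑ τ ∈ Y, a τ ≤ Real.exp c * ∑ τ ∈ Y, a τ :=
    mul_le_mul_of_nonneg_right e1 hYA
  have h2 : (1 - W) * ∑ τ ∈ T, a τ ≤ ∑ τ ∈ G, a τ + ∑ τ ∈ Y, a τ := by
    have : (1 - W) * ∑ τ ∈ T, a τ = ∑ τ ∈ T, a τ - W * ∑ τ ∈ T, a τ := by ring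
    linarith
  have h3 : Real.exp (c - r) * ((1 - W) * ∑ τ ∈ T, a τ) ≤
      Real.exp (c - r) * (∑ τ ∈ G, a τ + ∑ τ ∈ Y, a τ) :=
    mul_le_mul_of_nonneg_left h2 (Real.exp_pos _).le
  have h4 : Real.exp (c - r) * (∑ τ ∈ G, a τ + ∑ τ ∈ Y, a τ) =
      Real.exp (c - r) * ∑ τ ∈ G, a τ + Real.exp (c - r) * ∑ τ ∈ Y, a τ := mul_add _ _ _
  have key : Real.exp (c - r) * (1 - (W + m * Real.exp r)) * ∑ τ ∈ T, a τ =
      Real.exp (c - r) * ((1 - W) * ∑ τ ∈ T, a τ) - m * Real.exp c * ∑ τ ∈ T, a τ := by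
    rw [← hexp]; ring
  rw [key, eSB]
  linarith

/-- The effective weight `W + m e^r` leaves room for the factor `1 + m`: `(1 − (W + m e^r))(1 + m) ≤ 1 − W` for
`r, W, m ≥ 0`. [folklore] -/
theorem one_sub_effWeight_mul_le (hr : 0 ≤ r) (hW : 0 ≤ W) (hm : 0 ≤ m) :
    (1 - (W + m * Real.exp r)) * (1 + m) ≤ 1 - W := by
  have e1 : 1 ≤ Real.exp r := by linarith [Real.add_one_le_exp r]
  have h1 : m * 1 ≤ m * Real.exp r := mul_le_mul_of_nonneg_left e1 hm
  have h2 : 0 ≤ m * W := mul_nonneg hm hW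
  have h3 : 0 ≤ m * (m * Real.exp r) := mul_nonneg hm (mul_nonneg hm (Real.exp_pos r).le)
  nlinarith

/-- **Upper bound, natural form**: `(1 − W) Σ_T b ≤ e^{c+r} (1 + m) Σ_T a` (for `r ≥ 0`, `m ≥ 0`). [folklore] -/
theorem upper_bound' (h : AddHybridSandwich T G Y a b c r W m) (hr : 0 ≤ r) (hm : 0 ≤ m) :
    (1 - W) * ∑ τ ∈ T, b τ ≤ Real.exp (c + r) * (1 + m) * ∑ τ ∈ T, a τ := by
  have eS := h.sum_eq a
  have eSB := h.sum_eq b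
  have hGB := h.sum_good_upper
  have hYB := h.sum_add_upper
  have hBA : 0 ≤ ∑ τ ∈ T \ (G ∪ Y), a τ :=
    Finset.sum_nonneg fun τ hτ => h.nonneg_left τ (Finset.mem_sdiff.1 hτ).1
  have hYA : 0 ≤ ∑ τ ∈ Y, a τ := Finset.sum_nonneg fun τ hτ => h.nonneg_left τ (h.add_subset hτ)
  have hGA : 0 ≤ ∑ τ ∈ G, a τ := Finset.sum_nonneg fun τ hτ => h.nonneg_left τ (h.good_subset hτ)
  have hS : 0 ≤ ∑ τ ∈ T, a τ := Finset.sum_nonneg h.nonneg_left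
  have hBB := h.bad_right
  have e1 : Real.exp c ≤ Real.exp (c + r) := Real.exp_le_exp.2 (by linarith)
  have h1 : Real.exp c * ∑ τ ∈ Y, a τ ≤ Real.exp (c + r) * ∑ τ ∈ Y, a τ :=
    mul_le_mul_of_nonneg_right e1 hYA
  have h2 : m * Real.exp c * ∑ τ ∈ T, a τ ≤ m * Real.exp (c + r) * ∑ τ ∈ T, a τ := by
    have := mul_le_mul_of_nonneg_right e1 hS
    have := mul_le_mul_of_nonneg_left this hm
    linarith [mul_assoc m (Real.exp c) (∑ τ ∈ T, a τ), mul_assoc m (Real.exp (c + r)) (∑ τ ∈ T, a τ)]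
  have h3 : Real.exp (c + r) * ∑ τ ∈ G, a τ + Real.exp (c + r) * ∑ τ ∈ Y, a τ ≤
      Real.exp (c + r) * ∑ τ ∈ T, a τ := by
    rw [eS, mul_add, mul_add]
    linarith [mul_nonneg (Real.exp_pos (c + r)).le hBA]
  have key : Real.exp (c + r) * (1 + m) * ∑ τ ∈ T, a τ =
      Real.exp (c + r) * ∑ τ ∈ T, a τ + m * Real.exp (c + r) * ∑ τ ∈ T, a τ := by ring
  have key2 : (1 - W) * ∑ τ ∈ T, b τ = ∑ τ ∈ T, b τ - W * ∑ τ ∈ T, b τ := by ring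
  rw [key, key2]
  linarith

/-- **Upper bound, slot form**: `(1 − (W + m e^r)) Σ_T b ≤ e^{c+r} Σ_T a` (for `r, W, m ≥ 0`). [folklore] -/
theorem upper_bound (h : AddHybridSandwich T G Y a b c r W m) (hr : 0 ≤ r) (hW : 0 ≤ W) (hm : 0 ≤ m) :
    (1 - (W + m * Real.exp r)) * ∑ τ ∈ T, b τ ≤ Real.exp (c + r) * ∑ τ ∈ T, a τ := by
  have hSB : 0 ≤ ∑ τ ∈ T, b τ := Finset.sum_nonneg h.nonneg_right
  have hS : 0 ≤ ∑ τ ∈ T, a τ := Finset.sum_nonneg h.nonneg_left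
  have h1 := h.upper_bound' hr hm
  have h2 := one_sub_effWeight_mul_le (r := r) hr hW hm
  have hm1 : 0 < 1 + m := by linarith
  -- (1 − W′) SB ≤ (1 − W)/(1+m) SB ≤ e^{c+r} S
  have h3 : (1 - (W + m * Real.exp r)) * ∑ τ ∈ T, b τ ≤ (1 - W) / (1 + m) * ∑ τ ∈ T, b τ := by
    refine mul_le_mul_of_nonneg_right ?_ hSB
    rw [le_div_iff₀ hm1]
    exact h2
  have h4 : (1 - W) / (1 + m) * ∑ τ ∈ T, b τ ≤ Real.exp (c + r) * ∑ τ ∈ T, a τ := by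
    rw [div_mul_eq_mul_div, div_le_iff₀ hm1]
    calc (1 - W) * ∑ τ ∈ T, b τ ≤ Real.exp (c + r) * (1 + m) * ∑ τ ∈ T, a τ := h1
      _ = (Real.exp (c + r) * ∑ τ ∈ T, a τ) * (1 + m) := by ring
  exact h3.trans h4

/-- Run B's total is positive as soon as run A's is and the effective weight is `< 1`. [folklore] -/
theorem sum_pos (h : AddHybridSandwich T G Y a b c r W m) (hr : 0 ≤ r)
    (hlt : W + m * Real.exp r < 1) (hpos : 0 < ∑ τ ∈ T, a τ) : 0 < ∑ τ ∈ T, b τ :=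
  lt_of_lt_of_le (mul_pos (mul_pos (Real.exp_pos _) (by linarith)) hpos) (h.lower_bound hr)

/-- **THE BOOKING RULE OF THE ADDITIVELY MATCHED CLASS** (node U5, three-class hybrid lemma): under
`AddHybridSandwich T G Y a b c r W m` with `r ≥ 0`, `W ≥ 0`, `W + m e^r < 1` and `Σ_T a > 0`,
`|log Σ_T b − log Σ_T a − c| ≤ r − log(1 − (W + m·e^r))`.
The additively matched class enters the WEIGHT SLOT of `T4HybridMatching.hybridDelta` THROUGH ITS MISMATCH `m·e^r`,
NOT THROUGH ITS WEIGHT: nothing is assumed about `Σ_Y a / Σ_T a` (it may be any fraction, `Y` may even be all of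
`T ∖ bad`).  Sharp at `r = 0` (`addHybridSandwich_sharp`). [folklore] -/
theorem abs_log_sum_sub_le (h : AddHybridSandwich T G Y a b c r W m) (hr : 0 ≤ r) (hW : 0 ≤ W)
    (hlt : W + m * Real.exp r < 1) (hpos : 0 < ∑ τ ∈ T, a τ) :
    |Real.log (∑ τ ∈ T, b τ) - Real.log (∑ τ ∈ T, a τ) - c| ≤ r - Real.log (1 - (W + m * Real.exp r)) := by
  have hm := h.m_nonneg hpos
  have hW' : 0 < 1 - (W + m * Real.exp r) := by linarith
  have hB := h.sum_pos hr hlt hpos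
  have hlow := Real.log_le_log (mul_pos (mul_pos (Real.exp_pos _) hW') hpos) (h.lower_bound hr)
  rw [Real.log_mul (mul_pos (Real.exp_pos _) hW').ne' hpos.ne',
    Real.log_mul (Real.exp_pos _).ne' hW'.ne', Real.log_exp] at hlow
  have hupp := Real.log_le_log (mul_pos hW' hB) (h.upper_bound hr hW hm)
  rw [Real.log_mul hW'.ne' hB.ne', Real.log_mul (Real.exp_pos _).ne' hpos.ne', Real.log_exp] at hupp
  rw [abs_le]
  constructor <;> linarith

/-- Monotonicity in the three remainders (`r ≤ r′`, `W ≤ W′`, `m ≤ m′`). [folklore] -/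
theorem mono (h : AddHybridSandwich T G Y a b c r W m) {r' W' m' : ℝ} (hr : r ≤ r') (hW : W ≤ W') (hm : m ≤ m') :
    AddHybridSandwich T G Y a b c r' W' m' where
  good_subset := h.good_subset
  add_subset := h.add_subset
  disjoint := h.disjoint
  nonneg_left := h.nonneg_left
  nonneg_right := h.nonneg_right
  lower := fun τ hτ => (mul_le_mul_of_nonneg_right (Real.exp_le_exp.mpr (by linarith))
    (h.nonneg_left τ (h.good_subset hτ))).trans (h.lower τ hτ)
  upper := fun τ hτ => (h.upper τ hτ).trans (mul_le_mul_of_nonneg_right (Real.exp_le_exp.mpr (by linarith))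
    (h.nonneg_left τ (h.good_subset hτ)))
  bad_left := h.bad_left.trans (mul_le_mul_of_nonneg_right hW (Finset.sum_nonneg h.nonneg_left))
  bad_right := h.bad_right.trans (mul_le_mul_of_nonneg_right hW (Finset.sum_nonneg h.nonneg_right))
  add_match := h.add_match.trans (mul_le_mul_of_nonneg_right (mul_le_mul_of_nonneg_right hm (Real.exp_pos c).le)
    (Finset.sum_nonneg h.nonneg_left))

/-- Degenerate instance 1 — NO additively matched class: a `HybridSandwich` is an `AddHybridSandwich` with `Y = ∅`,
`m = 0`; then `abs_log_sum_sub_le` is `HybridSandwich.abs_log_sum_sub_le` verbatim (`W + 0·e^r = W`). [folklore] -/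
theorem of_hybridSandwich (h : HybridSandwich T G a b c r W) : AddHybridSandwich T G ∅ a b c r W 0 where
  good_subset := h.subset
  add_subset := Finset.empty_subset _
  disjoint := Finset.disjoint_empty_right _
  nonneg_left := h.nonneg_left
  nonneg_right := h.nonneg_right
  lower := h.lower
  upper := h.upper
  bad_left := by rw [Finset.union_empty]; exact h.bad_left
  bad_right := by rw [Finset.union_empty]; exact h.bad_right
  add_match := by simp

/-- Degenerate instance 2 — PURE AGGREGATE MATCHING (no good terms, no bad terms: `G = ∅`, `Y = T`, `W = 0`):
nonnegative families whose totals match additively modulo `c` with mismatch `m`. [folklore] -/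
theorem of_aggregate (ha : ∀ τ ∈ T, 0 ≤ a τ) (hb : ∀ τ ∈ T, 0 ≤ b τ)
    (hm : |∑ τ ∈ T, b τ - Real.exp c * ∑ τ ∈ T, a τ| ≤ m * Real.exp c * ∑ τ ∈ T, a τ) (r : ℝ) :
    AddHybridSandwich T ∅ T a b c r 0 m where
  good_subset := Finset.empty_subset _
  add_subset := Finset.Subset.refl _
  disjoint := Finset.disjoint_empty_left _
  nonneg_left := ha
  nonneg_right := hb
  lower := fun _ h => absurd h (Finset.notMem_empty _)
  upper := fun _ h => absurd h (Finset.notMem_empty _)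
  bad_left := by simp
  bad_right := by simp
  add_match := hm

/-- Pure aggregate matching ⇒ `|log Σ b − log Σ a − c| ≤ −log(1 − m)` (King's additive template in relative form: the
mismatch, not the size, is what is booked). [folklore] -/
theorem abs_log_sub_le_of_aggregate (ha : ∀ τ ∈ T, 0 ≤ a τ) (hb : ∀ τ ∈ T, 0 ≤ b τ)
    (hm : |∑ τ ∈ T, b τ - Real.exp c * ∑ τ ∈ T, a τ| ≤ m * Real.exp c * ∑ τ ∈ T, a τ) (hm1 : m < 1)
    (hpos : 0 < ∑ τ ∈ T, a τ) :
    |Real.log (∑ τ ∈ T, b τ) - Real.log (∑ τ ∈ T, a τ) - c| ≤ -Real.log (1 - m) := by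
  have h := (of_aggregate ha hb hm 0).abs_log_sum_sub_le le_rfl le_rfl (by simpa using hm1) hpos
  simpa using h

/-- CONSTRUCTOR FROM A GIVEN BAD CLASS (the form the `K`-level plugs use): `Bad, Y ⊆ T`, the term-wise sandwich OFF
`Bad ∪ Y`, the bad class's relative weights, and the aggregate matching of `Y` give the three-class sandwich with good
class `T ∖ (Bad ∪ Y)` (terms in `Bad ∩ Y` are booked additively — harmless). [folklore] -/
theorem of_bad {Bad : Finset ι} (hBad : Bad ⊆ T) (hY : Y ⊆ T) (ha : ∀ τ ∈ T, 0 ≤ a τ) (hb : ∀ τ ∈ T, 0 ≤ b τ)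
    (hl : ∀ τ ∈ T \ (Bad ∪ Y), Real.exp (c - r) * a τ ≤ b τ)
    (hu : ∀ τ ∈ T \ (Bad ∪ Y), b τ ≤ Real.exp (c + r) * a τ)
    (hbadA : ∑ τ ∈ Bad, a τ ≤ W * ∑ τ ∈ T, a τ) (hbadB : ∑ τ ∈ Bad, b τ ≤ W * ∑ τ ∈ T, b τ)
    (hadd : |∑ τ ∈ Y, b τ - Real.exp c * ∑ τ ∈ Y, a τ| ≤ m * Real.exp c * ∑ τ ∈ T, a τ) :
    AddHybridSandwich T (T \ (Bad ∪ Y)) Y a b c r W m := by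
  have hsub : T \ (T \ (Bad ∪ Y) ∪ Y) ⊆ Bad := by
    intro x hx
    rw [Finset.mem_sdiff, Finset.mem_union, Finset.mem_sdiff, Finset.mem_union] at hx
    obtain ⟨hxT, hx2⟩ := hx
    by_contra hxB
    by_cases hxY : x ∈ Y
    · exact hx2 (Or.inr hxY)
    · exact hx2 (Or.inl ⟨hxT, fun h' => h'.elim hxB hxY⟩)
  exact
    { good_subset := Finset.sdiff_subset
      add_subset := hY
      disjoint := Finset.disjoint_left.2 fun x hx hxY =>
        (Finset.mem_sdiff.1 hx).2 (Finset.mem_union_right _ hxY)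
      nonneg_left := ha
      nonneg_right := hb
      lower := hl
      upper := hu
      bad_left := (Finset.sum_le_sum_of_subset_of_nonneg hsub fun τ hτ _ => ha τ (hBad hτ)).trans hbadA
      bad_right := (Finset.sum_le_sum_of_subset_of_nonneg hsub fun τ hτ _ => hb τ (hBad hτ)).trans hbadB
      add_match := hadd }

end AddHybridSandwich

/-- **SHARPNESS of the booking rule at `r = 0`**: for all `W, m ≥ 0` with `W + m < 1` there are two-term families with
all hypotheses of `AddHybridSandwich` at `c = r = 0` (no good term; the additively matched term `1 − W ↔ 1 − W − m`;
the bad term `W ↔ 0`) and `|log Σ b − log Σ a − c| = −log(1 − (W + m·e^0))` — equality in `abs_log_sum_sub_le`.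
[folklore] -/
theorem addHybridSandwich_sharp {W m : ℝ} (hW : 0 ≤ W) (hm : 0 ≤ m) (hlt : W + m < 1) :
    ∃ a b : Bool → ℝ, AddHybridSandwich Finset.univ ∅ {true} a b 0 0 W m ∧ 0 < ∑ τ, a τ ∧
      |Real.log (∑ τ, b τ) - Real.log (∑ τ, a τ) - 0| = 0 - Real.log (1 - (W + m * Real.exp 0)) := by
  have hsd : (Finset.univ : Finset Bool) \ (∅ ∪ {true}) = {false} := by decide
  refine ⟨fun τ => if τ then 1 - W else W, fun τ => if τ then 1 - W - m else 0, ?_, ?_, ?_⟩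
  · refine ⟨Finset.empty_subset _, Finset.subset_univ _, Finset.disjoint_empty_left _, ?_, ?_, ?_, ?_, ?_, ?_, ?_⟩
    · intro τ _
      cases τ <;> simp <;> linarith
    · intro τ _
      cases τ <;> simp; linarith
    · intro τ hτ; exact absurd hτ (Finset.notMem_empty _)
    · intro τ hτ; exact absurd hτ (Finset.notMem_empty _)
    · rw [hsd, Finset.sum_singleton, Fintype.sum_bool]
      simp only [Bool.false_eq_true, if_false, if_true]
      linarith
    · rw [hsd, Finset.sum_singleton, Fintype.sum_bool]
      simp only [Bool.false_eq_true, if_false, if_true, add_zero]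
      nlinarith
    · rw [Finset.sum_singleton, Finset.sum_singleton, Fintype.sum_bool]
      simp only [if_true, Bool.false_eq_true, if_false, Real.exp_zero, one_mul, mul_one]
      rw [show (1 : ℝ) - W - m - (1 - W) = -m by ring, abs_neg, abs_of_nonneg hm]
      linarith
  · rw [Fintype.sum_bool]
    simp only [if_true, Bool.false_eq_true, if_false]
    linarith
  · rw [Fintype.sum_bool, Fintype.sum_bool]
    simp only [if_true, Bool.false_eq_true, if_false, add_zero, Real.exp_zero, mul_one, sub_zero, zero_sub]
    rw [show (1 : ℝ) - W + W = 1 by ring, Real.log_one, sub_zero, show (1 : ℝ) - W - m = 1 - (W + m) by ring,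
      abs_of_nonpos (Real.log_nonpos (by linarith) (by linarith))]

/-! ## §2 Producers of the aggregate mismatch: term-wise additive matching; rate × class constant -/

section Producers

variable {ι : Type*} {T Y : Finset ι} {a b d s : ι → ℝ} {c m ε C : ℝ}

/-- TERM-WISE ADDITIVE MATCHING ⇒ AGGREGATE MATCHING: if every term of the class is matched additively modulo `c`,
`|b_τ − e^c a_τ| ≤ e^c d_τ`, and the defects sum to `≤ m · Σ_T a`, then `|Σ_Y b − e^c Σ_Y a| ≤ m e^c Σ_T a`.  (The
aggregate form is the WEAKER hypothesis: it also admits cancellations between terms of the class, e.g. between the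
branches of one decomposition of unity.) [folklore] -/
theorem add_match_of_termwise (hd : ∀ τ ∈ Y, |b τ - Real.exp c * a τ| ≤ Real.exp c * d τ)
    (hsum : ∑ τ ∈ Y, d τ ≤ m * ∑ τ ∈ T, a τ) :
    |∑ τ ∈ Y, b τ - Real.exp c * ∑ τ ∈ Y, a τ| ≤ m * Real.exp c * ∑ τ ∈ T, a τ := by
  have h1 : ∑ τ ∈ Y, b τ - Real.exp c * ∑ τ ∈ Y, a τ = ∑ τ ∈ Y, (b τ - Real.exp c * a τ) := by
    rw [Finset.sum_sub_distrib, Finset.mul_sum]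
  rw [h1]
  calc |∑ τ ∈ Y, (b τ - Real.exp c * a τ)| ≤ ∑ τ ∈ Y, |b τ - Real.exp c * a τ| := Finset.abs_sum_le_sum_abs _ _
    _ ≤ ∑ τ ∈ Y, Real.exp c * d τ := Finset.sum_le_sum hd
    _ = Real.exp c * ∑ τ ∈ Y, d τ := by rw [Finset.mul_sum]
    _ ≤ Real.exp c * (m * ∑ τ ∈ T, a τ) := mul_le_mul_of_nonneg_left hsum (Real.exp_pos c).le
    _ = m * Real.exp c * ∑ τ ∈ T, a τ := by ring

/-- RATE × CLASS CONSTANT: if each defect is a RATE `ε` times a per-term SIZE `s_τ` (`d_τ ≤ ε s_τ`) and the class's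
total size is at most `C ×` run A's total (`Σ_Y s ≤ C Σ_T a`), then the defects sum to `≤ (ε C) Σ_T a`.  The two
CURRENCIES of the additively matched class: `ε` is a TWO-RUN rate (UV-anchored: the (F∞) width / running-coupling
discrepancy at the window, summable in `K`), `C` is a ONE-RUN class constant (IR-anchored: merely FINITE, uniformly in
`K`; no smallness, not even `C < 1`, is required by the booking rule). [folklore] -/
theorem sum_defect_le_of_rate (hε : 0 ≤ ε) (hd : ∀ τ ∈ Y, d τ ≤ ε * s τ)
    (hs : ∑ τ ∈ Y, s τ ≤ C * ∑ τ ∈ T, a τ) : ∑ τ ∈ Y, d τ ≤ ε * C * ∑ τ ∈ T, a τ :=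
  calc ∑ τ ∈ Y, d τ ≤ ∑ τ ∈ Y, ε * s τ := Finset.sum_le_sum hd
    _ = ε * ∑ τ ∈ Y, s τ := by rw [Finset.mul_sum]
    _ ≤ ε * (C * ∑ τ ∈ T, a τ) := mul_le_mul_of_nonneg_left hs hε
    _ = ε * C * ∑ τ ∈ T, a τ := by ring

/-- The two producers composed: term-wise defects at rate `ε` on sizes of total `≤ C Σ_T a` ⇒ aggregate matching with
mismatch `m = ε C`. [folklore] -/
theorem add_match_of_rate (hε : 0 ≤ ε) (hd : ∀ τ ∈ Y, |b τ - Real.exp c * a τ| ≤ Real.exp c * d τ)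
    (hrate : ∀ τ ∈ Y, d τ ≤ ε * s τ) (hs : ∑ τ ∈ Y, s τ ≤ C * ∑ τ ∈ T, a τ) :
    |∑ τ ∈ Y, b τ - Real.exp c * ∑ τ ∈ Y, a τ| ≤ ε * C * Real.exp c * ∑ τ ∈ T, a τ :=
  add_match_of_termwise hd (sum_defect_le_of_rate hε hrate hs)

end Producers

/-! ## §3 The plugs into node U6: remainder sequence, summability, `MatchingModConstants`, Cauchy -/

/-- THE EFFECTIVE WEIGHT SEQUENCE of the three-class matching: `addWeight vol δ W m K = W K + m K · exp(vol·δ K)` — the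
bad class's relative weight plus the additively matched class's MISMATCH inflated by the term-wise remainder.  The
remainder sequence of node U5 is then `T4HybridMatching.hybridDelta vol δ (addWeight vol δ W m)`. [folklore] -/
noncomputable def addWeight (vol : ℝ) (δ W m : ℕ → ℝ) (K : ℕ) : ℝ := W K + m K * Real.exp (vol * δ K)

/-- The effective weights are nonnegative for nonnegative data. [folklore] -/
theorem addWeight_nonneg {vol : ℝ} {δ W m : ℕ → ℝ} (hW : ∀ K, 0 ≤ W K) (hm : ∀ K, 0 ≤ m K) (K : ℕ) :
    0 ≤ addWeight vol δ W m K :=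
  add_nonneg (hW K) (mul_nonneg (hm K) (Real.exp_pos _).le)

/-- **Summability of the effective weights**: `Σ W < ∞`, `Σ m < ∞` (`m ≥ 0`) and `Σ δ < ∞` (so `δ` is bounded and the
inflation factors `exp(vol·δ K)` are uniformly bounded, `vol ≥ 0`) give `Σ_K addWeight vol δ W m K < ∞` — the class is
summable in `K` iff its MISMATCHES are. [folklore] -/
theorem summable_addWeight {vol : ℝ} {δ W m : ℕ → ℝ} (hvol : 0 ≤ vol) (hW : Summable W) (hm : Summable m)
    (hm0 : ∀ K, 0 ≤ m K) (hδ : Summable δ) : Summable (addWeight vol δ W m) := by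
  obtain ⟨D, hD⟩ := hδ.tendsto_atTop_zero.bddAbove_range
  have hD' : ∀ K, δ K ≤ D := fun K => hD ⟨K, rfl⟩
  refine hW.add (Summable.of_nonneg_of_le (fun K => mul_nonneg (hm0 K) (Real.exp_pos _).le)
    (fun K => mul_le_mul_of_nonneg_left (Real.exp_le_exp.2 (mul_le_mul_of_nonneg_left (hD' K) hvol)) (hm0 K))
    (hm.mul_right _))

section Plug

variable {ι : Type*} {vol l₀ : ℝ} {δ W m : ℕ → ℝ} {Z : ℕ → ℝ → ℝ}

/-- **Node U5 (three-class hybrid form) ⇒ `MatchingModConstants`** (mirror of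
`T4HybridMatching.matchingModConstants_of_hybrid`).  For every `K`, on `|t| ≤ l₀`: run A's dressed partition function is
`Σ_{τ ∈ T K} A K t τ > 0`, run B's is `Σ_{τ ∈ T K} B K t τ`, and for a `t`-INDEPENDENT constant `c_K` and some classes
`G, Y` the families satisfy `AddHybridSandwich` with term-wise remainder `vol·δ K ≥ 0`, bad weight `W K ≥ 0` and
mismatch `m K`, with `addWeight vol δ W m K < 1`.  Then `MatchingModConstants vol l₀ (hybridDelta vol δ (addWeight vol δ
W m)) Z`. [folklore] -/
theorem matchingModConstants_of_addHybrid [DecidableEq ι] (hvol : 0 < vol) (T : ℕ → Finset ι) (A B : ℕ → ℝ → ι → ℝ)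
    (hZA : ∀ K t, |t| ≤ l₀ → Z K t = ∑ τ ∈ T K, A K t τ)
    (hZB : ∀ K t, |t| ≤ l₀ → Z (K + 1) t = ∑ τ ∈ T K, B K t τ)
    (hδ0 : ∀ K, 0 ≤ δ K) (hW0 : ∀ K, 0 ≤ W K) (hlt : ∀ K, addWeight vol δ W m K < 1)
    (hpos : ∀ K t, |t| ≤ l₀ → 0 < ∑ τ ∈ T K, A K t τ)
    (h : ∀ K : ℕ, ∃ c : ℝ, ∀ t : ℝ, |t| ≤ l₀ →
      ∃ G Y : Finset ι, AddHybridSandwich (T K) G Y (A K t) (B K t) c (vol * δ K) (W K) (m K)) :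
    MatchingModConstants vol l₀ (hybridDelta vol δ (addWeight vol δ W m)) Z := by
  intro K
  obtain ⟨c, hc⟩ := h K
  refine ⟨c, fun t ht => ?_⟩
  obtain ⟨G, Y, hGY⟩ := hc t ht
  rw [hZA K t ht, hZB K t ht, mul_hybridDelta hvol.ne']
  exact hGY.abs_log_sum_sub_le (mul_nonneg hvol.le (hδ0 K)) (hW0 K) (hlt K) (hpos K t ht)

/-- **Node U5 (three-class hybrid form) + summable remainders ⇒ node U6's Cauchy property** (CONDITIONAL kernel theorem;
mirror of `T4HybridMatching.cauchy_of_hybrid`): under the hypotheses of `matchingModConstants_of_addHybrid`, `0 ≤ l₀`,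
`Σ δ < ∞`, `Σ W < ∞`, `Σ m < ∞` with `m ≥ 0`: matching modulo constants with summable remainders, every
generating-function sequence `K ↦ genFun Z K t`, `|t| ≤ l₀`, is Cauchy, and the convergence to `genFunLim Z` is uniform
on the closed `l₀`-ball.  None of the hypotheses is asserted for Bałaban's objects. [folklore] -/
theorem cauchy_of_addHybrid [DecidableEq ι] (hvol : 0 < vol) (hl₀ : 0 ≤ l₀) (T : ℕ → Finset ι) (A B : ℕ → ℝ → ι → ℝ)
    (hZA : ∀ K t, |t| ≤ l₀ → Z K t = ∑ τ ∈ T K, A K t τ)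
    (hZB : ∀ K t, |t| ≤ l₀ → Z (K + 1) t = ∑ τ ∈ T K, B K t τ)
    (hδ0 : ∀ K, 0 ≤ δ K) (hδ : Summable δ) (hW0 : ∀ K, 0 ≤ W K) (hWs : Summable W)
    (hm0 : ∀ K, 0 ≤ m K) (hms : Summable m) (hlt : ∀ K, addWeight vol δ W m K < 1)
    (hpos : ∀ K t, |t| ≤ l₀ → 0 < ∑ τ ∈ T K, A K t τ)
    (h : ∀ K : ℕ, ∃ c : ℝ, ∀ t : ℝ, |t| ≤ l₀ →
      ∃ G Y : Finset ι, AddHybridSandwich (T K) G Y (A K t) (B K t) c (vol * δ K) (W K) (m K)) :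
    MatchingModConstants vol l₀ (hybridDelta vol δ (addWeight vol δ W m)) Z ∧
      Summable (hybridDelta vol δ (addWeight vol δ W m)) ∧
      (∀ t : ℝ, |t| ≤ l₀ → CauchySeq fun K => genFun Z K t) ∧
      TendstoUniformlyOn (fun K t => genFun Z K t) (genFunLim Z) atTop {t | |t| ≤ l₀} := by
  have hM := matchingModConstants_of_addHybrid hvol T A B hZA hZB hδ0 hW0 hlt hpos h
  have hS := summable_hybridDelta (vol := vol) hδ (addWeight_nonneg hW0 hm0) hlt
    (summable_addWeight hvol.le hWs hms hm0 hδ)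
  exact ⟨hM, hS, fun t ht => cauchySeq_genFun hM hl₀ hS ht, tendstoUniformlyOn_genFun hM hl₀ hS⟩

variable {T : ℕ → Finset ι} {A B : ℕ → ℝ → ι → ℝ} {Bad Y : ℕ → ℝ → Finset ι}

/-- **NE7b-output + good-class matching OFF `Bad ∪ Y` + aggregate matching of `Y` with the SAME constants + summable
remainders ⇒ node U6's Cauchy property** — the three-class twin of `T4WeightBudget.cauchy_of_relWeightBound`
(CONDITIONAL kernel theorem).  The effective weight slot is `addWeight vol δ W m`. [folklore] -/
theorem cauchy_of_relWeightBound_add [DecidableEq ι] (hvol : 0 < vol) (hl₀ : 0 ≤ l₀) (hW : RelWeightBound l₀ T A B Bad W)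
    (hY : ∀ K t, |t| ≤ l₀ → Y K t ⊆ T K)
    (hZA : ∀ K t, |t| ≤ l₀ → Z K t = ∑ τ ∈ T K, A K t τ)
    (hZB : ∀ K t, |t| ≤ l₀ → Z (K + 1) t = ∑ τ ∈ T K, B K t τ)
    (hA : ∀ K t, |t| ≤ l₀ → ∀ τ ∈ T K, 0 ≤ A K t τ) (hB : ∀ K t, |t| ≤ l₀ → ∀ τ ∈ T K, 0 ≤ B K t τ)
    (hpos : ∀ K t, |t| ≤ l₀ → 0 < ∑ τ ∈ T K, A K t τ) (hδ0 : ∀ K, 0 ≤ δ K) (hδ : Summable δ)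
    (hm0 : ∀ K, 0 ≤ m K) (hms : Summable m) (hlt : ∀ K, addWeight vol δ W m K < 1)
    (hgood : ∀ K : ℕ, ∃ c : ℝ, ∀ t : ℝ, |t| ≤ l₀ →
      (∀ τ ∈ T K \ (Bad K t ∪ Y K t),
        Real.exp (c - vol * δ K) * A K t τ ≤ B K t τ ∧ B K t τ ≤ Real.exp (c + vol * δ K) * A K t τ) ∧
      |∑ τ ∈ Y K t, B K t τ - Real.exp c * ∑ τ ∈ Y K t, A K t τ| ≤ m K * Real.exp c * ∑ τ ∈ T K, A K t τ) :
    MatchingModConstants vol l₀ (hybridDelta vol δ (addWeight vol δ W m)) Z ∧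
      Summable (hybridDelta vol δ (addWeight vol δ W m)) ∧
      (∀ t : ℝ, |t| ≤ l₀ → CauchySeq fun K => genFun Z K t) ∧
      TendstoUniformlyOn (fun K t => genFun Z K t) (genFunLim Z) atTop {t | |t| ≤ l₀} := by
  refine cauchy_of_addHybrid hvol hl₀ T A B hZA hZB hδ0 hδ hW.nonneg hW.summable hm0 hms hlt hpos fun K => ?_
  obtain ⟨c, hc⟩ := hgood K
  refine ⟨c, fun t ht => ⟨T K \ (Bad K t ∪ Y K t), Y K t, ?_⟩⟩
  obtain ⟨hsw, hadd⟩ := hc t ht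
  exact AddHybridSandwich.of_bad (hW.bad_subset K t ht) (hY K t ht) (hA K t ht) (hB K t ht)
    (fun τ hτ => (hsw τ hτ).1) (fun τ hτ => (hsw τ hτ).2) (hW.bad_left K t ht) (hW.bad_right K t ht) hadd

variable {shA shB : ℕ → ℝ → ι → ℝ} {Wsh : ℕ → ℝ}

/-- The refined copy of a class: both pieces (core and shell) of each of its terms. [folklore] -/
def refY (Y : ℕ → ℝ → Finset ι) (K : ℕ) (t : ℝ) : Finset (ι ⊕ ι) := (Y K t).disjSum (Y K t)

/-- The refinement changes no class sum: `Σ_{refY} refVal = Σ_Y (weights)`. [folklore] -/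
theorem sum_refY_refVal (K : ℕ) (t : ℝ) :
    ∑ x ∈ refY Y K t, refVal A shA K t x = ∑ τ ∈ Y K t, A K t τ := by
  rw [refY, Finset.sum_disjSum]
  simp only [refVal_inl, refVal_inr, Finset.sum_sub_distrib]
  ring

/-- Membership in the refined good class off `refBad ∪ refY`: the core of an old term off `Bad ∪ Y`. [folklore] -/
theorem mem_refT_sdiff_refBad_union_refY [DecidableEq ι] {K : ℕ} {t : ℝ} {x : ι ⊕ ι}
    (hx : x ∈ refT T K \ (refBad T Bad K t ∪ refY Y K t)) :
    ∃ τ ∈ T K \ (Bad K t ∪ Y K t), x = Sum.inl τ := by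
  rw [Finset.mem_sdiff, Finset.mem_union, not_or] at hx
  obtain ⟨hxT, hxB, hxY⟩ := hx
  obtain ⟨τ, hτ, rfl⟩ := mem_refT_sdiff_refBad (Finset.mem_sdiff.2 ⟨hxT, hxB⟩)
  refine ⟨τ, Finset.mem_sdiff.2 ⟨(Finset.mem_sdiff.1 hτ).1, fun h => ?_⟩, rfl⟩
  rcases Finset.mem_union.1 h with hb | hy
  · exact (Finset.mem_sdiff.1 hτ).2 hb
  · exact hxY (by rw [refY]; exact Finset.inl_mem_disjSum.2 hy)

/-- **DESIGN (i)/(η) WITH AN ADDITIVELY MATCHED CLASS — NE7b-output + NE7c-output (shell slot) + core matching OFF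
`Bad ∪ Y` + aggregate matching of `Y` with the same constants + summable remainders ⇒ node U6's Cauchy property**: the
three-class twin of `T4IndicatorShell.cauchy_of_relWeightBound_shell` (CONDITIONAL kernel theorem; the refined
families of that file with the class `Y` refined into both of its pieces, `refY`).  Effective weight slot
`addWeight vol δ (W + Wsh) m K = W K + Wsh K + m K·exp(vol·δ K)`.  Every estimate is a hypothesis; nothing of
Bałaban's is asserted. [folklore] -/
theorem cauchy_of_relWeightBound_shell_add [DecidableEq ι] (hvol : 0 < vol) (hl₀ : 0 ≤ l₀)
    (hW : RelWeightBound l₀ T A B Bad W) (hSh : ShellWeightBound l₀ T A B shA shB Wsh)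
    (hY : ∀ K t, |t| ≤ l₀ → Y K t ⊆ T K)
    (hZA : ∀ K t, |t| ≤ l₀ → Z K t = ∑ τ ∈ T K, A K t τ)
    (hZB : ∀ K t, |t| ≤ l₀ → Z (K + 1) t = ∑ τ ∈ T K, B K t τ)
    (hpos : ∀ K t, |t| ≤ l₀ → 0 < ∑ τ ∈ T K, A K t τ) (hδ0 : ∀ K, 0 ≤ δ K) (hδ : Summable δ)
    (hm0 : ∀ K, 0 ≤ m K) (hms : Summable m)
    (hlt : ∀ K, addWeight vol δ (fun K => W K + Wsh K) m K < 1)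
    (hcore : ∀ K : ℕ, ∃ c : ℝ, ∀ t : ℝ, |t| ≤ l₀ →
      (∀ τ ∈ T K \ (Bad K t ∪ Y K t),
        Real.exp (c - vol * δ K) * (A K t τ - shA K t τ) ≤ B K t τ - shB K t τ ∧
          B K t τ - shB K t τ ≤ Real.exp (c + vol * δ K) * (A K t τ - shA K t τ)) ∧
      |∑ τ ∈ Y K t, B K t τ - Real.exp c * ∑ τ ∈ Y K t, A K t τ| ≤ m K * Real.exp c * ∑ τ ∈ T K, A K t τ) :
    MatchingModConstants vol l₀ (hybridDelta vol δ (addWeight vol δ (fun K => W K + Wsh K) m)) Z ∧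
      Summable (hybridDelta vol δ (addWeight vol δ (fun K => W K + Wsh K) m)) ∧
      (∀ t : ℝ, |t| ≤ l₀ → CauchySeq fun K => genFun Z K t) ∧
      TendstoUniformlyOn (fun K t => genFun Z K t) (genFunLim Z) atTop {t | |t| ≤ l₀} := by
  have hlt' : ∀ K, W K + Wsh K < 1 := fun K =>
    lt_of_le_of_lt (le_add_of_nonneg_right (mul_nonneg (hm0 K) (Real.exp_pos _).le)) (hlt K)
  have hZA' : ∀ K t, |t| ≤ l₀ → Z K t = ∑ x ∈ refT T K, refVal A shA K t x := fun K t ht => by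
    rw [sum_refT_refVal]; exact hZA K t ht
  have hZB' : ∀ K t, |t| ≤ l₀ → Z (K + 1) t = ∑ x ∈ refT T K, refVal B shB K t x := fun K t ht => by
    rw [sum_refT_refVal]; exact hZB K t ht
  have hA' : ∀ K t, |t| ≤ l₀ → ∀ x ∈ refT T K, 0 ≤ refVal A shA K t x := fun K t ht =>
    refVal_nonneg (hSh.sh_nonneg_left K t ht) (hSh.sh_le_left K t ht)
  have hB' : ∀ K t, |t| ≤ l₀ → ∀ x ∈ refT T K, 0 ≤ refVal B shB K t x := fun K t ht =>
    refVal_nonneg (hSh.sh_nonneg_right K t ht) (hSh.sh_le_right K t ht)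
  have hpos' : ∀ K t, |t| ≤ l₀ → 0 < ∑ x ∈ refT T K, refVal A shA K t x := fun K t ht => by
    rw [sum_refT_refVal]; exact hpos K t ht
  have hY' : ∀ K t, |t| ≤ l₀ → refY Y K t ⊆ refT T K := fun K t ht => by
    rw [refY, refT]; exact Finset.disjSum_mono (hY K t ht) (hY K t ht)
  refine cauchy_of_relWeightBound_add hvol hl₀ (relWeightBound_ref hW hSh hlt') hY' hZA' hZB' hA' hB' hpos' hδ0 hδ
    hm0 hms hlt fun K => ?_
  obtain ⟨c, hc⟩ := hcore K
  refine ⟨c, fun t ht => ⟨fun x hx => ?_, ?_⟩⟩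
  · obtain ⟨τ, hτ, rfl⟩ := mem_refT_sdiff_refBad_union_refY hx
    simpa only [refVal_inl] using (hc t ht).1 τ hτ
  · rw [sum_refY_refVal, sum_refY_refVal, sum_refT_refVal]
    exact (hc t ht).2

end Plug

/-! ## §4 Sanity and separation: a SATURATED class, additively matched, books; non-vacuity of the binders -/

namespace Sanity

/-- run A of the toy: the class `{true}` carries the CONSTANT fraction `q₀` of the total `1` at every `K`. [folklore] -/
def A (q₀ : ℝ) (_K : ℕ) (_t : ℝ) (τ : Bool) : ℝ := if τ then q₀ else 1 - q₀

/-- run B of the toy: the good term `false` is matched EXACTLY modulo the constant `c_K = −log(1 + η K)`, the class term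
`true` additively modulo the same constant with mismatch `η K`; the total is again `1`. [folklore] -/
noncomputable def B (q₀ : ℝ) (η : ℕ → ℝ) (K : ℕ) (_t : ℝ) (τ : Bool) : ℝ :=
  if τ then 1 - (1 - q₀) / (1 + η K) else (1 - q₀) / (1 + η K)

/-- the toy's partition functions: identically `1` (only the CLASS STRUCTURE is non-trivial). [folklore] -/
def Z (_K : ℕ) (_t : ℝ) : ℝ := 1

/-- the toy's class: `{true}` at every `K`. [folklore] -/
def Y (_K : ℕ) (_t : ℝ) : Finset Bool := {true}

/-- the toy has NO bad class. [folklore] -/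
def Bad (_K : ℕ) (_t : ℝ) : Finset Bool := ∅

variable {q₀ : ℝ} {η : ℕ → ℝ}

/-- run A's total is `1` at every `K`. [folklore] -/
theorem sum_A (q₀ : ℝ) (K : ℕ) (t : ℝ) : ∑ τ, A q₀ K t τ = 1 := by
  rw [Fintype.sum_bool]; simp [A]

/-- run B's total is `1` at every `K`. [folklore] -/
theorem sum_B (q₀ : ℝ) (η : ℕ → ℝ) (K : ℕ) (t : ℝ) : ∑ τ, B q₀ η K t τ = 1 := by
  rw [Fintype.sum_bool]; simp [B]

/-- SATURATION: the class keeps the constant relative weight `q₀` in run A at every `K` — so for `q₀ > 0` it is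
`T4BadClassBooking.Saturated` and admits NO `T4WeightBudget.RelWeightBound` for ANY weight sequence
(`T4BadClassBooking.not_relWeightBound_of_saturated`, cited by name; not re-proved here). [folklore] -/
theorem class_weight (q₀ : ℝ) (K : ℕ) (t : ℝ) :
    ∑ τ ∈ Y K t, A q₀ K t τ = q₀ * ∑ τ ∈ Finset.univ, A q₀ K t τ := by
  rw [sum_A]; simp [Y, A]

/-- The toy's three-class sandwich at step `K`: good class `{false}` matched exactly (`r = 0`) modulo
`c_K = −log(1 + η K)`, no bad class (`W = 0`), the class `{true}` additively matched with mismatch `η K`. [folklore] -/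
theorem addHybridSandwich {K : ℕ} (hq0 : 0 ≤ q₀) (hq1 : q₀ ≤ 1) (hη : 0 ≤ η K) (t : ℝ) :
    AddHybridSandwich Finset.univ {false} {true} (A q₀ K t) (B q₀ η K t) (-Real.log (1 + η K)) 0 0 (η K) := by
  have h1 : 0 < 1 + η K := by linarith
  have hexp : Real.exp (-Real.log (1 + η K)) = (1 + η K)⁻¹ := by
    rw [Real.exp_neg, Real.exp_log h1]
  have hsd : (Finset.univ : Finset Bool) \ ({false} ∪ {true}) = ∅ := by decide
  have hfrac0 : 0 ≤ (1 - q₀) / (1 + η K) := div_nonneg (by linarith) h1.le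
  have hfrac1 : (1 - q₀) / (1 + η K) ≤ 1 := by
    rw [div_le_one h1]; linarith
  refine ⟨Finset.subset_univ _, Finset.subset_univ _, by decide, ?_, ?_, ?_, ?_, ?_, ?_, ?_⟩
  · intro τ _; cases τ <;> simp [A] <;> linarith
  · intro τ _; cases τ <;> simp only [B, if_true, Bool.false_eq_true, if_false] <;> linarith
  · intro τ hτ
    rw [Finset.mem_singleton] at hτ; subst hτ
    simp only [A, B, Bool.false_eq_true, if_false, sub_zero, hexp, div_eq_inv_mul]
    exact le_rfl
  · intro τ hτ
    rw [Finset.mem_singleton] at hτ; subst hτ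
    simp only [A, B, Bool.false_eq_true, if_false, add_zero, hexp, div_eq_inv_mul]
    exact le_rfl
  · rw [hsd]; simp
  · rw [hsd]; simp
  · rw [Finset.sum_singleton, Finset.sum_singleton, sum_A]
    simp only [A, B, if_true, hexp, mul_one]
    have : (1 : ℝ) - (1 - q₀) / (1 + η K) - (1 + η K)⁻¹ * q₀ = η K * (1 + η K)⁻¹ := by
      field_simp; ring
    rw [this, abs_of_nonneg (mul_nonneg hη (inv_nonneg.2 h1.le))]

/-- **SEPARATION FROM THE SATURATION WALL.**  The toy class is saturated (`class_weight`: no weight booking for any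
`W`), yet — being additively matched with mismatches `η K` — it BOOKS: for `0 ≤ q₀ ≤ 1`, `0 ≤ η K < 1`, `Σ η < ∞`,
matching modulo constants with the summable remainders `hybridDelta vol 0 (addWeight vol 0 0 η)`, the Cauchy property
and uniform convergence (here of course trivially, `Z ≡ 1`; the content is the INHABITANT of the binders of
`cauchy_of_relWeightBound_add` with a non-empty, non-small class). [folklore] -/
theorem books {vol l₀ : ℝ} (hvol : 0 < vol) (hl₀ : 0 ≤ l₀) (hq0 : 0 ≤ q₀) (hq1 : q₀ ≤ 1)
    (hη0 : ∀ K, 0 ≤ η K) (hη1 : ∀ K, η K < 1) (hηs : Summable η) :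
    MatchingModConstants vol l₀ (hybridDelta vol (fun _ => 0) (addWeight vol (fun _ => 0) (fun _ => 0) η)) Z ∧
      Summable (hybridDelta vol (fun _ => 0) (addWeight vol (fun _ => 0) (fun _ => 0) η)) ∧
      (∀ t : ℝ, |t| ≤ l₀ → CauchySeq fun K => genFun Z K t) ∧
      TendstoUniformlyOn (fun K t => genFun Z K t) (genFunLim Z) atTop {t | |t| ≤ l₀} := by
  refine cauchy_of_addHybrid hvol hl₀ (fun _ => Finset.univ) (A q₀) (B q₀ η)
    (fun K t _ => (sum_A q₀ K t).symm) (fun K t _ => (sum_B q₀ η K t).symm) (fun _ => le_rfl) summable_zero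
    (fun _ => le_rfl) summable_zero hη0 hηs (fun K => ?_) (fun K t _ => by rw [sum_A]; exact one_pos) fun K => ?_
  · simp only [addWeight, mul_zero, Real.exp_zero, mul_one, zero_add]; exact hη1 K
  · refine ⟨-Real.log (1 + η K), fun t _ => ⟨{false}, {true}, ?_⟩⟩
    have := addHybridSandwich (K := K) hq0 hq1 (hη0 K) t
    simpa only [mul_zero] using this

/-- Concrete instance: `q₀ = 1/2` (half of the weight sits in the class at every `K`), `η K = (1/2)^{K+1}`. [folklore] -/
example : MatchingModConstants 1 1
    (hybridDelta 1 (fun _ => 0) (addWeight 1 (fun _ => 0) (fun _ => 0) fun K => (1 / 2 : ℝ) ^ (K + 1))) Z := by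
  have hη0 : ∀ K : ℕ, (0 : ℝ) ≤ (1 / 2 : ℝ) ^ (K + 1) := fun K => by positivity
  have hη1 : ∀ K : ℕ, (1 / 2 : ℝ) ^ (K + 1) < 1 := fun K =>
    pow_lt_one₀ (by norm_num) (by norm_num) (Nat.succ_ne_zero K)
  have hηs : Summable fun K : ℕ => (1 / 2 : ℝ) ^ (K + 1) := by
    simpa only [pow_succ] using
      (summable_geometric_of_lt_one (by norm_num : (0 : ℝ) ≤ 1 / 2) (by norm_num)).mul_right (1 / 2 : ℝ)
  exact (books (q₀ := 1 / 2) one_pos zero_le_one (by norm_num) (by norm_num) hη0 hη1 hηs).1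

end Sanity

/-! ## §5 Comparison with the two two-class bookings: sandwiched terms are additively matched; a FLOOR-FREE class
is booked by neither two-class device but books additively -/

section Comparison

variable {ι : Type*} {T Y : Finset ι} {a b s : ι → ℝ} {c r : ℝ}

/-- **Sandwich ⇒ additive.**  A sub-family `Y ⊆ T` that IS sandwiched term-wise, `e^{c−r} a_τ ≤ b_τ ≤ e^{c+r} a_τ`
with `r ≥ 0`, is additively matched in aggregate modulo the same constant with mismatch `e^r − 1` (`≈ r`): the
additive class contains the good-class bookkeeping to first order.  [folklore] -/
theorem add_match_of_sandwich (hYT : Y ⊆ T) (ha : ∀ τ ∈ T, 0 ≤ a τ) (hr : 0 ≤ r)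
    (hl : ∀ τ ∈ Y, Real.exp (c - r) * a τ ≤ b τ) (hu : ∀ τ ∈ Y, b τ ≤ Real.exp (c + r) * a τ) :
    |∑ τ ∈ Y, b τ - Real.exp c * ∑ τ ∈ Y, a τ| ≤ (Real.exp r - 1) * Real.exp c * ∑ τ ∈ T, a τ := by
  have hd : ∀ τ ∈ Y, |b τ - Real.exp c * a τ| ≤ Real.exp c * ((Real.exp r - 1) * a τ) := by
    intro τ hτ
    have ha' : 0 ≤ a τ := ha τ (hYT hτ)
    have hec : 0 ≤ Real.exp c := (Real.exp_pos c).le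
    -- `1 − e^{−r} ≤ r ≤ e^{r} − 1`
    have h3 : 1 - Real.exp (-r) ≤ Real.exp r - 1 := by
      linarith [Real.add_one_le_exp r, Real.add_one_le_exp (-r)]
    have h1 := hl τ hτ
    have h2 := hu τ hτ
    rw [sub_eq_add_neg, Real.exp_add] at h1
    rw [Real.exp_add] at h2
    have hca : 0 ≤ Real.exp c * a τ := mul_nonneg hec ha'
    rw [abs_le]
    constructor
    · nlinarith [mul_le_mul_of_nonneg_left h3 hca]
    · nlinarith
  have hsum : ∑ τ ∈ Y, (Real.exp r - 1) * a τ ≤ (Real.exp r - 1) * ∑ τ ∈ T, a τ := by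
    rw [← Finset.mul_sum]
    exact mul_le_mul_of_nonneg_left (Finset.sum_le_sum_of_subset_of_nonneg hYT fun τ hτ _ => ha τ hτ)
      (sub_nonneg.2 (Real.one_le_exp hr))
  exact add_match_of_termwise hd hsum

end Comparison

/-! ### The floor-free toy -/

namespace SanityFloorFree

/-- the class's FLOOR RATIO `q K = a/s = 1/(K+3)`: it tends to `0` (NO uniform floor) while `Σ q = ∞`
(NO weight booking). [folklore] -/
noncomputable def q (K : ℕ) : ℝ := 1 / ((K : ℝ) + 3)

/-- run A: bulk term `false` of weight `1 − q K`, class term `true` of weight `q K`; total `1`. [folklore] -/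
noncomputable def A (K : ℕ) (_t : ℝ) (τ : Bool) : ℝ := if τ then q K else 1 - q K

/-- run B: the class term moved ADDITIVELY by `q K ^ 2` (rate `ε = q²` against the reference size `s = 1`, so that
`ε/q = q` is NOT summable), the bulk term compensating; total `1`. [folklore] -/
noncomputable def B (K : ℕ) (_t : ℝ) (τ : Bool) : ℝ := if τ then q K + q K ^ 2 else 1 - q K - q K ^ 2

/-- the toy's partition functions: identically `1`. [folklore] -/
def Z (_K : ℕ) (_t : ℝ) : ℝ := 1

/-- the bulk's exact matching constant `c K = log((1 − q − q²)/(1 − q))`. [folklore] -/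
noncomputable def c (K : ℕ) : ℝ := Real.log ((1 - q K - q K ^ 2) / (1 - q K))

/-- the class's additive mismatch `m K = q²/(1 − q − q²)` (`≤ (9/5) q²`, summable). [folklore] -/
noncomputable def m (K : ℕ) : ℝ := q K ^ 2 / (1 - q K - q K ^ 2)

/-- the floor ratio is positive. [folklore] -/
theorem q_pos (K : ℕ) : 0 < q K := by
  unfold q; positivity

/-- the floor ratio is at most `1/3`. [folklore] -/
theorem q_le (K : ℕ) : q K ≤ 1 / 3 := by
  have hK : (0 : ℝ) ≤ K := Nat.cast_nonneg K
  exact one_div_le_one_div_of_le (by norm_num) (by linarith)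

/-- `1 − q − q² ≥ 5/9 > 0`. [folklore] -/
theorem denom_ge (K : ℕ) : 5 / 9 ≤ 1 - q K - q K ^ 2 := by
  have h0 := (q_pos K).le
  have h1 := q_le K
  nlinarith [mul_nonneg h0 (sub_nonneg.2 h1)]

/-- run A's total is `1`. [folklore] -/
theorem sum_A (K : ℕ) (t : ℝ) : ∑ τ, A K t τ = 1 := by
  rw [Fintype.sum_bool]; simp [A]

/-- run B's total is `1`. [folklore] -/
theorem sum_B (K : ℕ) (t : ℝ) : ∑ τ, B K t τ = 1 := by
  rw [Fintype.sum_bool]; simp only [B, if_true, Bool.false_eq_true, if_false]; ring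

/-- NO FLOOR: the floor ratio tends to `0`. [folklore] -/
theorem tendsto_q : Tendsto q atTop (𝓝 0) := by
  -- `1/(n+1) → 0`, shifted by `2`
  have h2 : Tendsto (fun K : ℕ => 1 / (((K + 2 : ℕ) : ℝ) + 1)) atTop (𝓝 0) :=
    (tendsto_one_div_add_atTop_nhds_zero_nat (𝕜 := ℝ)).comp (tendsto_add_atTop_nat 2)
  refine h2.congr fun K => ?_
  rw [q]; push_cast; ring

/-- NO WEIGHT BOOKING: `Σ q = ∞`. [folklore] -/
theorem not_summable_q : ¬ Summable q := by
  intro h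
  have h3 : Summable fun K : ℕ => 1 / ((K + 3 : ℕ) : ℝ) := by
    refine h.congr fun K => ?_
    simp only [q, Nat.cast_add, Nat.cast_ofNat]
  exact Real.not_summable_one_div_natCast ((summable_nat_add_iff 3).1 h3)

/-- the additive mismatches are summable (`m ≤ (9/5) q²`, `q² ≤ 1/(K+1)²`-type comparison). [folklore] -/
theorem summable_m : Summable m := by
  have hq2 : Summable fun K : ℕ => q K ^ 2 := by
    have h : Summable fun n : ℕ => 1 / ((n : ℝ) ^ 2) := Real.summable_one_div_nat_pow.mpr one_lt_two
    have h3 : Summable fun K : ℕ => 1 / (((K + 3 : ℕ) : ℝ) ^ 2) := (summable_nat_add_iff 3).2 h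
    refine h3.congr fun K => ?_
    simp only [q, Nat.cast_add, Nat.cast_ofNat, one_div, inv_pow]
  refine (hq2.mul_left (9 / 5)).of_nonneg_of_le (fun K => ?_) fun K => ?_
  · exact div_nonneg (sq_nonneg _) (by linarith [denom_ge K])
  · unfold m
    rw [div_le_iff₀ (by linarith [denom_ge K])]
    nlinarith [denom_ge K, sq_nonneg (q K)]

/-- the mismatches are nonnegative. [folklore] -/
theorem m_nonneg (K : ℕ) : 0 ≤ m K := div_nonneg (sq_nonneg _) (by linarith [denom_ge K])

/-- the mismatches are `< 1` (in fact `≤ 1/5`), so `hlt` holds from `K₀ = 0`. [folklore] -/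
theorem m_lt_one (K : ℕ) : m K < 1 := by
  unfold m
  rw [div_lt_one (by linarith [denom_ge K])]
  nlinarith [denom_ge K, q_le K, (q_pos K).le]

/-- The three-class sandwich of the floor-free toy at step `K`: bulk `{false}` matched EXACTLY (`r = 0`) modulo `c K`,
no bad class (`W = 0`), class `{true}` additively matched with mismatch `m K` (reference size `s = 1 = Σ_T a`,
ceiling constant `C = 1`, rate `q K ^ 2`). [folklore] -/
theorem addHybridSandwich (K : ℕ) (t : ℝ) :
    AddHybridSandwich Finset.univ {false} {true} (A K t) (B K t) (c K) 0 0 (m K) := by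
  have hq0 := (q_pos K).le
  have hq1 := q_le K
  have hden := denom_ge K
  have h1q : 0 < 1 - q K := by linarith
  have hρ : 0 < (1 - q K - q K ^ 2) / (1 - q K) := div_pos (by linarith) h1q
  have hexp : Real.exp (c K) = (1 - q K - q K ^ 2) / (1 - q K) := by
    rw [c, Real.exp_log hρ]
  have hsd : (Finset.univ : Finset Bool) \ ({false} ∪ {true}) = ∅ := by decide
  refine ⟨Finset.subset_univ _, Finset.subset_univ _, by decide, ?_, ?_, ?_, ?_, ?_, ?_, ?_⟩
  · intro τ _; cases τ <;> simp only [A, if_true, Bool.false_eq_true, if_false] <;> linarith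
  · intro τ _; cases τ <;> simp only [B, if_true, Bool.false_eq_true, if_false] <;> nlinarith
  · intro τ hτ
    rw [Finset.mem_singleton] at hτ; subst hτ
    simp only [A, B, Bool.false_eq_true, if_false, sub_zero, hexp]
    rw [div_mul_cancel₀ _ h1q.ne']
  · intro τ hτ
    rw [Finset.mem_singleton] at hτ; subst hτ
    simp only [A, B, Bool.false_eq_true, if_false, add_zero, hexp]
    rw [div_mul_cancel₀ _ h1q.ne']
  · rw [hsd]; simp
  · rw [hsd]; simp
  · rw [Finset.sum_singleton, Finset.sum_singleton, sum_A]
    simp only [A, B, if_true, hexp, mul_one]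
    have hval : q K + q K ^ 2 - (1 - q K - q K ^ 2) / (1 - q K) * q K = q K ^ 2 / (1 - q K) := by
      field_simp; ring
    have hm : m K * ((1 - q K - q K ^ 2) / (1 - q K)) = q K ^ 2 / (1 - q K) := by
      unfold m; field_simp
    rw [hval, hm, abs_of_nonneg (div_nonneg (sq_nonneg _) h1q.le)]

/-- **NO TWO-CLASS BOOKING.**  For the floor-free toy there are NO sequences of good sets, constants, term-wise
mismatches and bad weights booking every step by the two-class lemma `T4HybridMatching.HybridSandwich` with BOTH
`Σ r < ∞` and `Σ W < ∞`: at each `K`, either the class term is good — then the bulk pins `c ≤ r` and the class forces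
`2r ≥ log(1 + q K) ≥ q K/2` — or a term is bad — then `W ≥ q K`; and `Σ q = ∞`.  (The weight half is the saturation /
divergence wall of `T4BadClassBooking` in its `Σ = ∞` form; the sandwich half is the FLOOR: `r ≳ ε/q`, rate over floor
ratio, cf. `T4SiblingInsertion`'s `r̄ = 1/c`.) [folklore] -/
theorem no_twoClass_booking (t : ℝ) :
    ¬ ∃ (G : ℕ → Finset Bool) (c r W : ℕ → ℝ),
      (∀ K, HybridSandwich Finset.univ (G K) (A K t) (B K t) (c K) (r K) (W K)) ∧ Summable r ∧ Summable W := by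
  rintro ⟨G, c, r, W, h, hr, hW⟩
  have key : ∀ K, q K / 4 ≤ |r K| + |W K| := by
    intro K
    have hq0 := q_pos K
    have hq1 := q_le K
    have hK := h K
    have habsr : r K ≤ |r K| := le_abs_self _
    have habsW : W K ≤ |W K| := le_abs_self _
    have hr0 : 0 ≤ |r K| := abs_nonneg _
    have hW0 : 0 ≤ |W K| := abs_nonneg _
    by_cases h1 : true ∈ G K
    · by_cases h0 : false ∈ G K
      · -- both good: bulk lower half pins `c − r ≤ 0`, class upper half forces `1 + q ≤ e^{c+r} ≤ e^{2r}`
        have hl0 := hK.lower false h0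
        have hu1 := hK.upper true h1
        simp only [A, B, Bool.false_eq_true, if_false, if_true] at hl0 hu1
        have hcr : Real.exp (c K - r K) ≤ 1 := by
          by_contra hcon
          rw [not_le] at hcon
          have : 1 * (1 - q K) < Real.exp (c K - r K) * (1 - q K) :=
            mul_lt_mul_of_pos_right hcon (by linarith)
          nlinarith [sq_nonneg (q K)]
        have hcr' : c K - r K ≤ 0 := by
          rw [← Real.exp_le_exp, Real.exp_zero]; exact hcr
        have h1q : 1 + q K ≤ Real.exp (c K + r K) := by
          by_contra hcon
          rw [not_le] at hcon
          have : Real.exp (c K + r K) * q K < (1 + q K) * q K := mul_lt_mul_of_pos_right hcon hq0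
          nlinarith
        have h2r : 1 + q K ≤ Real.exp (2 * r K) :=
          h1q.trans (Real.exp_le_exp.2 (by linarith))
        -- `log(1+q) ≥ q/(1+q) ≥ q/2`
        have hlog : q K / 2 ≤ Real.log (1 + q K) := by
          have hpos : 0 < 1 + q K := by linarith
          have hl1 := Real.log_le_sub_one_of_pos (inv_pos.2 hpos)
          rw [Real.log_inv] at hl1
          have hl2 : (1 + q K)⁻¹ = 1 - q K / (1 + q K) := by field_simp; ring
          have hl3 : q K / 2 ≤ q K / (1 + q K) := div_le_div_of_nonneg_left hq0.le hpos (by linarith)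
          rw [hl2] at hl1
          linarith
        have h2r' : Real.log (1 + q K) ≤ 2 * r K := by
          have := Real.log_le_log (by linarith) h2r
          rwa [Real.log_exp] at this
        linarith
      · -- bulk bad: `W ≥ 1 − q ≥ q`
        have hbad := hK.bad_left
        rw [sum_A, mul_one] at hbad
        have hmem : false ∈ (Finset.univ : Finset Bool) \ G K := by simp [h0]
        have hle : A K t false ≤ ∑ τ ∈ Finset.univ \ G K, A K t τ :=
          Finset.single_le_sum (fun τ _ => hK.nonneg_left τ (Finset.mem_univ τ)) hmem
        have hval : A K t false = 1 - q K := by simp [A]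
        rw [hval] at hle
        linarith
    · -- class bad: `W ≥ q`
      have hbad := hK.bad_left
      rw [sum_A, mul_one] at hbad
      have hmem : true ∈ (Finset.univ : Finset Bool) \ G K := by simp [h1]
      have hle : A K t true ≤ ∑ τ ∈ Finset.univ \ G K, A K t τ :=
        Finset.single_le_sum (fun τ _ => hK.nonneg_left τ (Finset.mem_univ τ)) hmem
      have hval : A K t true = q K := by simp [A]
      rw [hval] at hle
      linarith
  have hs : Summable fun K => |r K| + |W K| := hr.abs.add hW.abs
  have hq : Summable fun K => q K / 4 :=
    hs.of_nonneg_of_le (fun K => by linarith [(q_pos K).le]) key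
  exact not_summable_q ((hq.mul_left 4).congr fun K => by ring)

/-- **… YET IT BOOKS ADDITIVELY**: matching modulo constants with the summable remainders
`hybridDelta vol 0 (addWeight vol 0 0 m)`, the Cauchy property and uniform convergence, from `cauchy_of_addHybrid`
with the three-class data `addHybridSandwich` — no floor, no weight booking, no term-wise sandwich of the class.
[folklore] -/
theorem books {vol l₀ : ℝ} (hvol : 0 < vol) (hl₀ : 0 ≤ l₀) :
    MatchingModConstants vol l₀ (hybridDelta vol (fun _ => 0) (addWeight vol (fun _ => 0) (fun _ => 0) m)) Z ∧
      Summable (hybridDelta vol (fun _ => 0) (addWeight vol (fun _ => 0) (fun _ => 0) m)) ∧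
      (∀ t : ℝ, |t| ≤ l₀ → CauchySeq fun K => genFun Z K t) ∧
      TendstoUniformlyOn (fun K t => genFun Z K t) (genFunLim Z) atTop {t | |t| ≤ l₀} := by
  refine cauchy_of_addHybrid hvol hl₀ (fun _ => Finset.univ) A B
    (fun K t _ => (sum_A K t).symm) (fun K t _ => (sum_B K t).symm) (fun _ => le_rfl) summable_zero
    (fun _ => le_rfl) summable_zero m_nonneg summable_m (fun K => ?_) (fun K t _ => by rw [sum_A]; exact one_pos)
    fun K => ⟨c K, fun t _ => ⟨{false}, {true}, by simpa only [mul_zero] using addHybridSandwich K t⟩⟩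
  simp only [addWeight, mul_zero, Real.exp_zero, mul_one, zero_add]; exact m_lt_one K

/-- closed instance `vol = l₀ = 1`. [folklore] -/
example : MatchingModConstants 1 1 (hybridDelta 1 (fun _ => 0) (addWeight 1 (fun _ => 0) (fun _ => 0) m)) Z :=
  (books one_pos zero_le_one).1

end SanityFloorFree

end Literature.MathematicalPhysics.QuantumFieldTheory.Balaban1983to89.T4AdditiveClass
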